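import Summits.AtomisticToContinuum.FouriersLaw.Theorems.BondHeatUncertaintyLinearResponseFTURBondHeatVarianceContinuityHelper3

/-!
# Helper 4 for stub `stub_bondHeatVarianceContinuity` (crux ★ `LinearResponseFTUR`, stmt-AtomisticToContinuum-9122):
# the NESS family is weakly continuous at `δ = 0`

Support file for line `lebesgue-flip-duality`, stub K6b (H2 of the stub plan). For the pinned chain (all
parameters `> 0`, `N ≥ 2`), under weak-NESS uniqueness (U), along a steady-state family `μ` and for `T > 0`:
`μ_{N, T+δ/2, T-δ/2} ⇒ μ_{N, T, T}` weakly as `δ → 0` (`ness_tendsto_integral`: convergence of `∫ g dμ_δ` for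
every bounded continuous `g`). Proof: the uniform exponential moments of Helper 3 make the family tight
(Markov), so by Prokhorov every sequence `δ_n → 0` has a weakly convergent subsequence; every limit point is
a probability measure solving the weak stationary Fokker–Planck equation at `(T, T)` (the generator is AFFINE
in the bath temperatures, `generator_affine`, and `L f` is bounded continuous for `f ∈ C_c^∞`) whose bond
currents are integrable (Fatou for `e^{ϑH}`), hence equals `μ_{N,T,T}` by (U); a unique limit point in a
compact set forces convergence (`tendsto_of_subseq_tendsto`). Nothing here closes an item.
-/

noncomputable section

namespace Summit.AtomisticToContinuum.FouriersLaw.Theorems.LinearResponseFTUR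

open MeasureTheory ProbabilityTheory Filter Topology Set
open scoped NNReal ENNReal Topology ContDiff BoundedContinuousFunction
open Literature.MathematicalPhysics.KineticTheory.HeatConduction Literature.Probability.Process OscillatorChain
open Summit.AtomisticToContinuum.FouriersLaw.Theorems.BondHeatUncertainty

/-- The generator of an oscillator chain is affine in the bath temperatures:
`L_{a,b} = L_{0,0} + a (L_{1,0} - L_{0,0}) + b (L_{0,1} - L_{0,0})`. [folklore] -/
private theorem generator_affine (P : OscillatorChain) (N : ℕ) (a b : ℝ) (f : PhaseSpace N → ℝ)
    (x : PhaseSpace N) :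
    P.generator N a b f x = P.generator N 0 0 f x + a * (P.generator N 1 0 f x - P.generator N 0 0 f x) +
      b * (P.generator N 0 1 f x - P.generator N 0 0 f x) := by
  unfold OscillatorChain.generator
  have key : ∀ i ∈ (Finset.univ : Finset (Fin N)),
      ((if i.val = 0 then a * partialP i (partialP i f) x - x.2 i * partialP i f x else 0) +
        (if i.val = N - 1 then b * partialP i (partialP i f) x - x.2 i * partialP i f x else 0)) =
      ((if i.val = 0 then 0 * partialP i (partialP i f) x - x.2 i * partialP i f x else 0) +
        (if i.val = N - 1 then 0 * partialP i (partialP i f) x - x.2 i * partialP i f x else 0)) +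
      a * (((if i.val = 0 then 1 * partialP i (partialP i f) x - x.2 i * partialP i f x else 0) +
        (if i.val = N - 1 then 0 * partialP i (partialP i f) x - x.2 i * partialP i f x else 0)) -
        ((if i.val = 0 then 0 * partialP i (partialP i f) x - x.2 i * partialP i f x else 0) +
        (if i.val = N - 1 then 0 * partialP i (partialP i f) x - x.2 i * partialP i f x else 0))) +
      b * (((if i.val = 0 then 0 * partialP i (partialP i f) x - x.2 i * partialP i f x else 0) +
        (if i.val = N - 1 then 1 * partialP i (partialP i f) x - x.2 i * partialP i f x else 0)) -
        ((if i.val = 0 then 0 * partialP i (partialP i f) x - x.2 i * partialP i f x else 0) +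
        (if i.val = N - 1 then 0 * partialP i (partialP i f) x - x.2 i * partialP i f x else 0))) := by
    intro i _
    split_ifs <;> ring
  rw [Finset.sum_congr rfl key]
  simp only [Finset.sum_add_distrib, Finset.sum_sub_distrib, ← Finset.mul_sum]
  ring

/-- **Weak continuity of the NESS family at `δ = 0`** (registered sub-goal of `stub_bondHeatVarianceContinuity`,
H2 of its plan): for the pinned chain (all parameters `> 0`), under weak-NESS uniqueness and along a
steady-state family `μ`, for `T > 0`, `N ≥ 2` and every bounded continuous `g`,
`∫ g dμ_{N,T+δ/2,T-δ/2} → ∫ g dμ_{N,T,T}` as `δ → 0`, `δ ≠ 0` (tightness from Helper 3, Prokhorov, closedness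
of the weak Fokker–Planck class under such limits, uniqueness at `(T, T)`). [folklore] -/
theorem ness_tendsto_integral :
    ∀ ω₂ lam β γ : ℝ, 0 < ω₂ → 0 < lam → 0 < β → 0 < γ →
    (∀ (N : ℕ) (T_L T_R : ℝ), 0 < T_L → 0 < T_R → ∀ μ ν : Measure (PhaseSpace N),
      (pinnedChain ω₂ lam β γ).IsSteadyState N T_L T_R μ →
      (pinnedChain ω₂ lam β γ).IsSteadyState N T_L T_R ν → μ = ν) →
    ∀ μ : (N : ℕ) → ℝ → ℝ → Measure (PhaseSpace N),
      (∀ (N : ℕ) (T_L T_R : ℝ), 0 < T_L → 0 < T_R →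
        (pinnedChain ω₂ lam β γ).IsSteadyState N T_L T_R (μ N T_L T_R)) →
    ∀ T : ℝ, 0 < T → ∀ (N : ℕ), 2 ≤ N →
    ∀ g : PhaseSpace N → ℝ, Continuous g → ∀ C : ℝ, (∀ x, |g x| ≤ C) →
      Tendsto (fun δ : ℝ => ∫ x, g x ∂(μ N (T + δ / 2) (T - δ / 2))) (𝓝[≠] 0)
        (𝓝 (∫ x, g x ∂(μ N T T))) := by
  intro ω₂ lam β γ hω hl hβ hγ huniq μ hμ T hT N hN g hg C hgC
  set P := pinnedChain ω₂ lam β γ with hP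
  set ϑ : ℝ := 1 / (2 * T) with hϑ
  have hϑ0 : 0 < ϑ := by positivity
  set V : PhaseSpace N → ℝ := fun x => Real.exp (ϑ * P.hamiltonian N x) with hV
  have hVc : Continuous V :=
    Real.continuous_exp.comp (continuous_const.mul (pinnedChain_continuous_hamiltonian ω₂ lam β γ N))
  obtain ⟨M, hM⟩ := ness_uniform_exp_moment ω₂ lam β γ hω hl hβ hγ huniq μ hμ T hT N hN
  -- positivity of the temperatures on the box
  have hpos : ∀ δ : ℝ, |δ| ≤ T → 0 < T + δ / 2 ∧ 0 < T - δ / 2 := fun δ hδ => by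
    have h := abs_le.1 hδ
    exact ⟨by linarith only [hT, h.1], by linarith only [hT, h.2]⟩
  have hprob : ∀ δ : ℝ, |δ| ≤ T → IsProbabilityMeasure (μ N (T + δ / 2) (T - δ / 2)) := fun δ hδ =>
    (hμ N _ _ (hpos δ hδ).1 (hpos δ hδ).2).1
  have hprob0 : IsProbabilityMeasure (μ N T T) := (hμ N T T hT hT).1
  -- the family as probability measures
  let pm : ℝ → ProbabilityMeasure (PhaseSpace N) := fun δ =>
    if h : |δ| ≤ T then ⟨μ N (T + δ / 2) (T - δ / 2), hprob δ h⟩ else ⟨μ N T T, hprob0⟩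
  have hpm : ∀ δ : ℝ, |δ| ≤ T →
      ((pm δ : ProbabilityMeasure (PhaseSpace N)) : Measure (PhaseSpace N)) = μ N (T + δ / 2) (T - δ / 2) := by
    intro δ hδ
    simp only [pm, dif_pos hδ]
    rfl
  -- tightness of the family (Markov's inequality with the uniform exponential moments) and Prokhorov
  set S : Set (ProbabilityMeasure (PhaseSpace N)) := {ν | ∃ δ : ℝ, |δ| ≤ T ∧ ν = pm δ} with hS
  have htight : IsTightMeasureSet
      {x | ∃ ν ∈ S, ((ν : ProbabilityMeasure (PhaseSpace N)) : Measure (PhaseSpace N)) = x} := by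
    refine Literature.Probability.Process.MarkovSemigroup.isTightMeasureSet_of_lintegral_le
      (V := fun x => (V x).toNNReal) (continuous_real_toNNReal.comp hVc)
      (fun R => pinnedChain_isCompact_setOf_exp_le hω hl.le hβ.le γ N hϑ0 R) (C := ENNReal.ofReal M)
      ENNReal.ofReal_ne_top ?_
    rintro _ ⟨ν, ⟨δ, hδ, rfl⟩, rfl⟩
    rw [hpm δ hδ]
    obtain ⟨hint, hle⟩ := hM δ hδ
    have h1 : ∫⁻ x, ((V x).toNNReal : ℝ≥0∞) ∂(μ N (T + δ / 2) (T - δ / 2)) =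
        ENNReal.ofReal (∫ x, V x ∂(μ N (T + δ / 2) (T - δ / 2))) := by
      rw [ofReal_integral_eq_lintegral_ofReal hint (Eventually.of_forall fun x => (Real.exp_pos _).le)]
      rfl
    rw [h1]
    exact ENNReal.ofReal_le_ofReal hle
  have hcomp := isCompact_closure_of_isTightMeasureSet htight
  ----------------------------------------------------------------
  -- identification of the subsequential limits: weak steady states at `(T, T)`, hence `μ N T T`
  ----------------------------------------------------------------
  have hident : ∀ s : ℕ → ℝ, Tendsto s atTop (𝓝 0) → ∀ ν : ProbabilityMeasure (PhaseSpace N),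
      Tendsto (fun n => pm (s n)) atTop (𝓝 ν) →
      ((ν : ProbabilityMeasure (PhaseSpace N)) : Measure (PhaseSpace N)) = μ N T T := by
    intro s hs ν hlim
    have hsT : ∀ᶠ n in atTop, |s n| ≤ T := by
      have h : ∀ᶠ δ : ℝ in 𝓝 0, |δ| ≤ T := by
        have : Metric.closedBall (0 : ℝ) T ∈ 𝓝 (0 : ℝ) := Metric.closedBall_mem_nhds 0 hT
        filter_upwards [this] with δ hδ
        simpa [Real.dist_eq] using hδ
      exact hs.eventually h
    -- (2) the weak stationary Fokker–Planck equation at `(T, T)`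
    have hgen : ∀ f : PhaseSpace N → ℝ, ContDiff ℝ (⊤ : ℕ∞) f → HasCompactSupport f →
        ∫ x, P.generator N T T f x ∂(ν : Measure (PhaseSpace N)) = 0 := by
      intro f hf hfc
      have hf2 : ContDiff ℝ 2 f := hf.of_le (by norm_cast)
      have hU1 := pinnedChain_contDiff_U ω₂ lam β γ (n := 1)
      have hV1 := pinnedChain_contDiff_V ω₂ lam β γ (n := 1)
      have hLc : ∀ a b : ℝ, Continuous (P.generator N a b f) := fun a b =>
        P.continuous_generator hU1 hV1 N a b hf2
      have hLb : ∀ a b : ℝ, ∃ Cab : ℝ, ∀ x, ‖P.generator N a b f x‖ ≤ Cab := fun a b =>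
        P.exists_bound_generator hU1 hV1 N a b hf2 hfc
      obtain ⟨C00, hC00⟩ := hLb 0 0
      obtain ⟨C10, hC10⟩ := hLb 1 0
      obtain ⟨C01, hC01⟩ := hLb 0 1
      obtain ⟨CTT, hCTT⟩ := hLb T T
      set A : PhaseSpace N → ℝ := fun x => P.generator N 1 0 f x - P.generator N 0 0 f x with hA
      set B : PhaseSpace N → ℝ := fun x => P.generator N 0 1 f x - P.generator N 0 0 f x with hB
      have hAc : Continuous A := (hLc 1 0).sub (hLc 0 0)
      have hBc : Continuous B := (hLc 0 1).sub (hLc 0 0)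
      have hAb : ∀ x, ‖A x‖ ≤ C10 + C00 := fun x => (norm_sub_le _ _).trans (add_le_add (hC10 x) (hC00 x))
      have hBb : ∀ x, ‖B x‖ ≤ C01 + C00 := fun x => (norm_sub_le _ _).trans (add_le_add (hC01 x) (hC00 x))
      -- along the sequence: `∫ L_{T,T} f dμ_{s_n} = -(s_n/2) (∫ A - ∫ B)`
      have hseq : ∀ n, |s n| ≤ T → ∫ x, P.generator N T T f x ∂(pm (s n) : Measure (PhaseSpace N)) =
          -(s n / 2) * ((∫ x, A x ∂(μ N (T + s n / 2) (T - s n / 2))) -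
            ∫ x, B x ∂(μ N (T + s n / 2) (T - s n / 2))) := by
        intro n hn
        rw [hpm _ hn]
        set ρ := μ N (T + s n / 2) (T - s n / 2) with hρ
        haveI : IsProbabilityMeasure ρ := hprob _ hn
        have hss := hμ N _ _ (hpos _ hn).1 (hpos _ hn).2
        have h0 : ∫ x, P.generator N (T + s n / 2) (T - s n / 2) f x ∂ρ = 0 := hss.2.1 f hf hfc
        have hintL : ∀ a b : ℝ, Integrable (P.generator N a b f) ρ := fun a b =>
          P.integrable_generator hU1 hV1 N a b hf2 hfc ρ
        have hintA : Integrable A ρ := (hintL 1 0).sub (hintL 0 0)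
        have hintB : Integrable B ρ := (hintL 0 1).sub (hintL 0 0)
        have hpt : ∀ x, P.generator N T T f x =
            P.generator N (T + s n / 2) (T - s n / 2) f x + (-(s n / 2)) * A x + (s n / 2) * B x := by
          intro x
          rw [generator_affine P N T T f x, generator_affine P N (T + s n / 2) (T - s n / 2) f x]
          simp only [hA, hB]
          ring
        simp_rw [hpt]
        have hI1 : Integrable (fun x => P.generator N (T + s n / 2) (T - s n / 2) f x + -(s n / 2) * A x) ρ :=
          (hintL _ _).add (hintA.const_mul _)
        have hI2 : Integrable (fun x => s n / 2 * B x) ρ := hintB.const_mul _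
        have hI3 : Integrable (fun x => -(s n / 2) * A x) ρ := hintA.const_mul _
        rw [integral_add hI1 hI2, integral_add (hintL _ _) hI3, integral_const_mul, integral_const_mul, h0]
        ring
      have hto0 : Tendsto (fun n => ∫ x, P.generator N T T f x ∂(pm (s n) : Measure (PhaseSpace N)))
          atTop (𝓝 0) := by
        have hbound : ∀ᶠ n in atTop, ‖∫ x, P.generator N T T f x ∂(pm (s n) : Measure (PhaseSpace N))‖ ≤
            |s n| / 2 * ((C10 + C00) + (C01 + C00)) := by
          filter_upwards [hsT] with n hn
          rw [hseq n hn]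
          set ρ := μ N (T + s n / 2) (T - s n / 2) with hρ
          haveI : IsProbabilityMeasure ρ := hprob _ hn
          have h1 : ‖∫ x, A x ∂ρ‖ ≤ C10 + C00 := by
            refine (norm_integral_le_of_norm_le_const (Eventually.of_forall hAb)).trans ?_
            simp
          have h2 : ‖∫ x, B x ∂ρ‖ ≤ C01 + C00 := by
            refine (norm_integral_le_of_norm_le_const (Eventually.of_forall hBb)).trans ?_
            simp
          rw [norm_mul, norm_neg, Real.norm_eq_abs, abs_div, abs_two]
          refine mul_le_mul_of_nonneg_left ((norm_sub_le _ _).trans (add_le_add h1 h2)) (by positivity)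
        refine squeeze_zero_norm' hbound ?_
        have h : Tendsto (fun n => |s n| / 2 * ((C10 + C00) + (C01 + C00))) atTop
            (𝓝 (|0| / 2 * ((C10 + C00) + (C01 + C00)))) :=
          ((continuous_abs.tendsto 0).comp hs |>.div_const 2).mul_const _
        simpa using h
      -- weak convergence tested on the bounded continuous function `L_{T,T} f`
      let Lb : PhaseSpace N →ᵇ ℝ := BoundedContinuousFunction.ofNormedAddCommGroup
        (P.generator N T T f) (hLc T T) CTT hCTT
      have hwk := (ProbabilityMeasure.tendsto_iff_forall_integral_tendsto.1 hlim) Lb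
      exact tendsto_nhds_unique hwk hto0
    -- (3) the bond currents are integrable under the limit (Fatou for `e^{ϑH}`)
    have hintV : Integrable V (ν : Measure (PhaseSpace N)) := by
      have hopen : ∀ G, IsOpen G → (ν : Measure (PhaseSpace N)) G ≤
          atTop.liminf (fun n => ((pm (s n) : ProbabilityMeasure (PhaseSpace N)) : Measure (PhaseSpace N)) G) :=
        fun G hG => ProbabilityMeasure.le_liminf_measure_open_of_tendsto hlim hG
      have h1 := lintegral_le_liminf_lintegral_of_forall_isOpen_measure_le_liminf_measure
        (μ := (ν : Measure (PhaseSpace N)))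
        (μs := fun n => ((pm (s n) : ProbabilityMeasure (PhaseSpace N)) : Measure (PhaseSpace N)))
        (f := V) hVc (fun x => (Real.exp_pos _).le) hopen
      have h2 : atTop.liminf (fun n => ∫⁻ x, ENNReal.ofReal (V x)
          ∂((pm (s n) : ProbabilityMeasure (PhaseSpace N)) : Measure (PhaseSpace N))) ≤ ENNReal.ofReal M := by
        refine liminf_le_of_frequently_le' (hsT.mono fun n hn => ?_).frequently
        rw [hpm _ hn]
        obtain ⟨hint, hle⟩ := hM _ hn
        rw [← ofReal_integral_eq_lintegral_ofReal hint (Eventually.of_forall fun x => (Real.exp_pos _).le)]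
        exact ENNReal.ofReal_le_ofReal hle
      refine ⟨hVc.aestronglyMeasurable, ?_⟩
      show ∫⁻ x, ‖V x‖ₑ ∂(ν : Measure (PhaseSpace N)) < (⊤ : ℝ≥0∞)
      have h3 : ∫⁻ x, ‖V x‖ₑ ∂(ν : Measure (PhaseSpace N)) = ∫⁻ x, ENNReal.ofReal (V x) ∂(ν : Measure (PhaseSpace N)) :=
        lintegral_congr fun x => Real.enorm_eq_ofReal (Real.exp_pos _).le
      rw [h3]
      exact lt_of_le_of_lt (h1.trans h2) ENNReal.ofReal_lt_top
    have hνss : P.IsSteadyState N T T (ν : Measure (PhaseSpace N)) :=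
      ⟨inferInstance, hgen, fun i =>
        pinnedChain_integrable_bondCurrent_of_integrable_exp hω.le hl.le hβ.le γ N hϑ0 hintV i⟩
    exact huniq N T T hT hT _ _ hνss (hμ N T T hT hT)
  ----------------------------------------------------------------
  -- conclusion: every sequence has a subsequence along which the integrals converge
  ----------------------------------------------------------------
  refine tendsto_of_subseq_tendsto fun ns hns => ?_
  have hns0 : Tendsto ns atTop (𝓝 0) := hns.mono_right nhdsWithin_le_nhds
  have hnsT : ∀ᶠ n in atTop, |ns n| ≤ T := by
    have h : ∀ᶠ δ : ℝ in 𝓝 0, |δ| ≤ T := by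
      have : Metric.closedBall (0 : ℝ) T ∈ 𝓝 (0 : ℝ) := Metric.closedBall_mem_nhds 0 hT
      filter_upwards [this] with δ hδ
      simpa [Real.dist_eq] using hδ
    exact hns0.eventually h
  have hev : ∀ᶠ n in atTop, pm (ns n) ∈ closure S :=
    hnsT.mono fun n hn => subset_closure (show pm (ns n) ∈ S from ⟨ns n, hn, rfl⟩)
  have hfreq : ∃ᶠ n in atTop, pm (ns n) ∈ closure S := hev.frequently
  obtain ⟨ν, -, φ, hφ, hlim⟩ := hcomp.tendsto_subseq' hfreq
  have hφT : ∀ᶠ n in atTop, |ns (φ n)| ≤ T := hφ.tendsto_atTop.eventually hnsT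
  have hν := hident (ns ∘ φ) (hns0.comp hφ.tendsto_atTop) ν hlim
  refine ⟨φ, ?_⟩
  have hgC' : ∀ x, ‖g x‖ ≤ C := fun x => by rw [Real.norm_eq_abs]; exact hgC x
  let gb : PhaseSpace N →ᵇ ℝ := BoundedContinuousFunction.ofNormedAddCommGroup g hg C hgC'
  have hwk := (ProbabilityMeasure.tendsto_iff_forall_integral_tendsto.1 hlim) gb
  rw [hν] at hwk
  refine hwk.congr' ?_
  filter_upwards [hφT] with n hn
  change ∫ x, g x ∂((pm (ns (φ n)) : ProbabilityMeasure (PhaseSpace N)) : Measure (PhaseSpace N)) = _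
  rw [hpm _ hn]

end Summit.AtomisticToContinuum.FouriersLaw.Theorems.LinearResponseFTUR

end
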